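import Literature.NumberTheory.LFunctions.PrimeDirichletPolynomialMoments
import Literature.NumberTheory.LFunctions.DirichletPolynomialGallagher
import HarnessLib

/-!
# Moments of prime Dirichlet polynomials in a vertical strip `α ≤ Re s ≤ α + L` (Balazard–de Roton 2008, Prop. 13)

Topic `Literature/NumberTheory/LFunctions`. Everything in this file is PROVED (no definitions, no
named facts).

M. Balazard, A. de Roton, arXiv:0810.3587, Prop. 13 (= H. Maier, H. L. Montgomery 2009, Lemma 5) in
the printed generality "`Re s_i ≥ α`" (here `α ≤ Re s_i ≤ α + L`, the factor `1 + 2L log T` coming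
from the tree's hybrid discrete mean value theorem, Huxley Ch. 19):
`Literature.NumberTheory.LFunctions.sum_norm_primePoly_pow_le_strip`,

  `Σ_r |Σ_{p ∈ S} a(p) p^{−s_r}|^{2k} ≤ 26 T (1 + log T)(1 + 2L log T) · k! (Σ_p |a(p)|² p^{−2α})^k`

for `1`-spaced ordinates in `[−T, T]` and `N^k ≤ T`. The weighted coefficient bound
`Σ_n |b(n)|² n^{−2α} ≤ k! (Σ_p |a(p)|² p^{−2α})^k` (`PrimePolyMomentsStrip.sum_norm_sq_powCoeff_weight_le`)
is reduced to the unweighted one (`PrimePolyMoments.sum_norm_sq_powCoeff_le`) applied to `a(p) p^{−α}`.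

## References

* [BalazardDeRoton2008] M. Balazard, A. de Roton, arXiv:0810.3587, Prop. 13. [cite: BalazardDeRoton2008, Prop. 13]
* H. Maier, H. L. Montgomery, Bull. London Math. Soc. 41 (2009), Lemma 5.
-/

noncomputable section

open Complex Finset Fintype

namespace Literature.NumberTheory.LFunctions

namespace PrimePolyMomentsStrip

open PrimePolyMoments

/-- On a fiber of `n`, twisting the coefficients by `p^{−α}` twists `Π a(f i)` by `n^{−α}`. [folklore] -/
theorem powCoeff_twist (S : Finset ℕ) (a : ℕ → ℂ) (k n : ℕ) (α : ℝ) :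
    powCoeff S (fun p ↦ a p * (p : ℂ) ^ (-(α : ℂ))) k n = powCoeff S a k n * (n : ℂ) ^ (-(α : ℂ)) := by
  classical
  unfold powCoeff
  rw [Finset.sum_mul]
  refine Finset.sum_congr rfl fun f hf ↦ ?_
  rw [mem_fiber] at hf
  rw [Finset.prod_mul_distrib]
  congr 1
  have := map_prod (cpowHom (-(α : ℂ))) f Finset.univ
  simp only [cpowHom_apply] at this
  rw [← this, hf.2]

/-- **`Σ_n |b(n)|² n^{−2α} ≤ k! (Σ_p |a(p)|² p^{−2α})^k`** for the coefficients `b = powCoeff` of `P^k`.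
[cite: BalazardDeRoton2008, Prop. 13 (proof)] -/
theorem sum_norm_sq_powCoeff_weight_le {S : Finset ℕ} {k N : ℕ} (hS : ∀ p ∈ S, p.Prime)
    (hSN : ∀ p ∈ S, p ≤ N) (a : ℕ → ℂ) (α : ℝ) :
    ∑ n ∈ Finset.Icc 1 (N ^ k), ‖powCoeff S a k n‖ ^ 2 * (n : ℝ) ^ (-(2 * α)) ≤
      k.factorial * (∑ p ∈ S, ‖a p‖ ^ 2 * (p : ℝ) ^ (-(2 * α))) ^ k := by
  have hnorm : ∀ n : ℕ, 0 < n → ‖(n : ℂ) ^ (-(α : ℂ))‖ ^ 2 = (n : ℝ) ^ (-(2 * α)) := by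
    intro n hn
    rw [show (-(α : ℂ)) = ((-α : ℝ) : ℂ) by push_cast; ring, Complex.norm_natCast_cpow_of_pos hn,
      Complex.ofReal_re, ← Real.rpow_natCast, ← Real.rpow_mul (Nat.cast_nonneg n)]
    congr 1; push_cast; ring
  have h := sum_norm_sq_powCoeff_le (k := k) hS hSN (fun p ↦ a p * (p : ℂ) ^ (-(α : ℂ)))
  calc ∑ n ∈ Finset.Icc 1 (N ^ k), ‖powCoeff S a k n‖ ^ 2 * (n : ℝ) ^ (-(2 * α))
      = ∑ n ∈ Finset.Icc 1 (N ^ k), ‖powCoeff S (fun p ↦ a p * (p : ℂ) ^ (-(α : ℂ))) k n‖ ^ 2 := by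
        refine Finset.sum_congr rfl fun n hn ↦ ?_
        rw [Finset.mem_Icc] at hn
        rw [powCoeff_twist, norm_mul, mul_pow, hnorm n hn.1]
    _ ≤ k.factorial * (∑ p ∈ S, ‖a p * (p : ℂ) ^ (-(α : ℂ))‖ ^ 2) ^ k := h
    _ = k.factorial * (∑ p ∈ S, ‖a p‖ ^ 2 * (p : ℝ) ^ (-(2 * α))) ^ k := by
        congr 2
        refine Finset.sum_congr rfl fun p hp ↦ ?_
        rw [norm_mul, mul_pow, hnorm p (hS p hp).pos]

end PrimePolyMomentsStrip

open PrimePolyMoments PrimePolyMomentsStrip in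
/-- **Balazard–de Roton 2008, Prop. 13 (Maier–Montgomery, Lemma 5), points in a vertical strip.**
Let `S` be a finite set of primes `≤ N`, `a : ℕ → ℂ`, `k` with `N^k ≤ T`, `T ≥ 1`, `L > 0`, `α ∈ ℝ`,
and `𝒮` a finite set of complex points with `α ≤ Re s ≤ α + L`, `|Im s| ≤ T`, ordinates pairwise
`≥ 1` apart. Then
`Σ_{s ∈ 𝒮} |Σ_{p ∈ S} a(p) p^{−s}|^{2k} ≤ 26 T (1 + log T)(1 + 2L log T) · k! (Σ_{p∈S} |a(p)|² p^{−2α})^k`.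
[cite: BalazardDeRoton2008, Prop. 13] -/
theorem sum_norm_primePoly_pow_le_strip (S : Finset ℕ) (hS : ∀ p ∈ S, p.Prime) {N : ℕ} (hN : 1 ≤ N)
    (hSN : ∀ p ∈ S, p ≤ N) (a : ℕ → ℂ) (k : ℕ) {T L α : ℝ} (hT : 1 ≤ T) (hL : 0 < L)
    (hNT : ((N ^ k : ℕ) : ℝ) ≤ T) (𝒮 : Finset ℂ) (hre : ∀ s ∈ 𝒮, α ≤ s.re ∧ s.re ≤ α + L)
    (him : ∀ s ∈ 𝒮, |s.im| ≤ T) (hsep : ∀ s ∈ 𝒮, ∀ s' ∈ 𝒮, s ≠ s' → 1 ≤ |s.im - s'.im|) :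
    ∑ s ∈ 𝒮, ‖∑ p ∈ S, a p * (p : ℂ) ^ (-s)‖ ^ (2 * k) ≤
      26 * T * (1 + Real.log T) * (1 + 2 * L * Real.log T) *
        (k.factorial * (∑ p ∈ S, ‖a p‖ ^ 2 * (p : ℝ) ^ (-(2 * α))) ^ k) := by
  have hS1 : ∀ p ∈ S, 1 ≤ p := fun p hp ↦ (hS p hp).one_lt.le
  have hNk : 1 ≤ N ^ k := Nat.one_le_pow _ _ hN
  have hpow : ∀ s : ℂ, ‖∑ p ∈ S, a p * (p : ℂ) ^ (-s)‖ ^ (2 * k) =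
      ‖∑ n ∈ Finset.Icc 1 (N ^ k), powCoeff S a k n * (n : ℂ) ^ (-s)‖ ^ 2 := by
    intro s
    rw [← primePoly_pow_eq hS1 hSN a, norm_pow, ← pow_mul, mul_comm k 2]
  simp_rw [hpow]
  have hT0 : 0 < T := by linarith
  have hmvt := Gallagher.discreteMeanValue_complex' (powCoeff S a k) (N ^ k) hT0 one_pos hL 𝒮 hre him hsep
  have hcoef := sum_norm_sq_powCoeff_weight_le (k := k) hS hSN a α
  have hNk' : (1 : ℝ) ≤ ((N ^ k : ℕ) : ℝ) := by exact_mod_cast hNk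
  have hlogN : Real.log ((N ^ k : ℕ) : ℝ) ≤ Real.log T := Real.log_le_log (by positivity) hNT
  have hlogN0 : 0 ≤ Real.log ((N ^ k : ℕ) : ℝ) := Real.log_nonneg hNk'
  have hlogT : 0 ≤ Real.log T := Real.log_nonneg hT
  have hW0 : 0 ≤ ∑ p ∈ S, ‖a p‖ ^ 2 * (p : ℝ) ^ (-(2 * α)) :=
    Finset.sum_nonneg fun p _ ↦ by positivity
  have hC0 : 0 ≤ (k.factorial : ℝ) * (∑ p ∈ S, ‖a p‖ ^ 2 * (p : ℝ) ^ (-(2 * α))) ^ k := by positivity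
  push_cast at hmvt hNT hNk' hlogN hlogN0 hcoef ⊢
  calc ∑ s ∈ 𝒮, ‖∑ n ∈ Finset.Icc 1 (N ^ k), powCoeff S a k n * (n : ℂ) ^ (-s)‖ ^ 2
      ≤ (5 * (T + 1 / 2) + 18 * (N : ℝ) ^ k) * (1⁻¹ + Real.log ((N : ℝ) ^ k)) * (1 + 2 * L * Real.log ((N : ℝ) ^ k)) *
          ∑ n ∈ Finset.Icc 1 (N ^ k), ‖powCoeff S a k n‖ ^ 2 * (n : ℝ) ^ (-(2 * α)) := hmvt
    _ ≤ (5 * (T + 1 / 2) + 18 * T) * (1⁻¹ + Real.log T) * (1 + 2 * L * Real.log T) *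
          ((k.factorial : ℝ) * (∑ p ∈ S, ‖a p‖ ^ 2 * (p : ℝ) ^ (-(2 * α))) ^ k) := by
        gcongr
    _ ≤ 26 * T * (1 + Real.log T) * (1 + 2 * L * Real.log T) *
          (k.factorial * (∑ p ∈ S, ‖a p‖ ^ 2 * (p : ℝ) ^ (-(2 * α))) ^ k) := by
        rw [inv_one]
        have h1 : 5 * (T + 1 / 2) + 18 * T ≤ 26 * T := by linarith
        have h2 : 0 ≤ (1 + Real.log T) * (1 + 2 * L * Real.log T) *
            ((k.factorial : ℝ) * (∑ p ∈ S, ‖a p‖ ^ 2 * (p : ℝ) ^ (-(2 * α))) ^ k) := by positivity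
        nlinarith [h1, h2]

end Literature.NumberTheory.LFunctions
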